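import Summits.BirchSwinnertonDyer.BirchSwinnertonDyer.Theorems.KimAtThreeD7uTamagawaCartesian
import Summits.BirchSwinnertonDyer.BirchSwinnertonDyer.Theorems.KimAtThreeD7uTamagawaDefect
import Summits.BirchSwinnertonDyer.Rank1Residual.GaloisImage.KolyvaginInjectivityAllDepths
import HarnessLib

/-!
# The TAMAGAWA-DIVISIBLE bad places, XII: the VANISHING dévissage for Kolyvagin systems and its step
# `k ⟹ k + 1` for Büyükboduk's structure `𝓕_{u-ℓ}` on `E[3^{k+1}·3]` (towards Büyükboduk 2009 Cor. 2.8 /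
# Thm. 3.1 for `T₃E` at every exponent, all reduction types, `p = 3`)
# (cell `bsd-addord`, seat w2-tamdiv gen 5; route W2 `KimAtThreeKolyvagin`, items 19562 / 19560, «TamDiv∞»)

HONEST FRAMING: TOOL theorems (no definition, no named fact, no `sorry`); closes nothing by itself;
nothing is booked; BSD is not proved by any of this.  CONDITIONAL on the same named binders as part IX
(`KimAtThreeD7uTamagawaDefect`, the exponent-one defect: a Poitou–Tate family `inv`, Tate's local
Euler–Poincaré characteristic `hEP`, the level-one prime choice `hprime` = Chebotarev) and on the tower
data of n1011's all-depth dévissage (`TorsionLevel.apply_eq_zero_of_apply_eq_zero_allDepths`: no `Γ_ℚ`-fixed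
points, (H.2)-shape cokernels for `τ` at every level, canonical admissible Kolyvagin data `D j` on
`E[3^j·3]` with ONE prime set and ONE `η`).

## What

Büyükboduk, JNT 129 (2009) Thm. 3.1 proves `κ^{Kato} ∈ pⁿ KS(T_pE)` for `pⁿ ∣ c_ℓ` through Cor. 2.8
«`KS(T/𝔪ⁿT, 𝓕_{u-ℓ}, 𝒫_n) = 0`», itself from [MR04] Thm. 4.2.2 (core rank `0` ⇒ `KS = 0`), which needs
H.1–H.6 — in particular `p ≥ 5` for elliptic curves (H.4) and the CARTESIAN property H.6 of `𝓕_{u-ℓ}`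
(his Prop. 2.7).  Here `p = 3`: the length-one vanishing is n1011's theorem (Rubin PCMI Thm. 2.7.6 with the
Chebotarev binder), assembled with the strictness `𝓕_u(ℓ) ⊊ 𝓕_can(ℓ)` in part IX; this file climbs to
length `k + 1` by the VANISHING form of n1011-p15's Kolyvagin-system dévissage along
`0 → E[3] → E[3^{k+1}·3] → E[3^k·3] → 0`, the cartesian input at the modified place `ℓ` being part XI
(`KimAtThreeD7uTamagawaCartesian`) under `Φ_ℓ[3^j] ⊆ 3 Φ_ℓ`.

* §1 (any number field, any modules) **`KSDevissageVanishing.apply_eq_zero_of_devissage_of_forall`**: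
  `KS(𝓕₁) = 0 ∧ KS(𝓕₃) = 0 ⇒ KS(𝓕₂) = 0` along `0 → M₁ → M₂ → M₃` (push forward, then lift).
* §2 **`apply_eq_zero_blochKatoUpdate_succ`**: the step `k ⟹ k + 1` for
  `𝓕_{u-ℓ}^{(j)} = (𝓕_can on E[3^j·3], replaced at ℓ by 𝓕_u(ℓ)_j)`.
* Sequel (part XIII, `KimAtThreeD7uTamagawaDefectExponent`): the induction — for every `k`, if `3 ∣ c_ℓ` and
  `Φ_ℓ[3^k] ⊆ 3Φ_ℓ`, then `KS(E[3^k·3], 𝓕_{u-ℓ}^{(k)}, D k) = 0`, and every Kolyvagin system for any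
  `𝓕₀ ≤ 𝓕_{u-ℓ}^{(k)}` ([MR04] Remark A.5's `𝓕_u`) vanishes in `H¹(ℚ, E[3^{k+1}])`.

References: K. Büyükboduk, JNT 129 (2009) Prop. 2.7, Cor. 2.8, Thm. 3.1, Cor. 3.3; B. Mazur, K. Rubin,
Mem. AMS 799 (2004) Thm. 4.2.2, Prop. 6.2.6, App. A Remark A.5; R. Sakamoto, JTNB 36 (2024) Def. 3.5,
Def. 4.1, Thm. 4.4; K. Rubin, PCMI 18 (2011) Thm. 2.7.6.
-/

noncomputable section

-- the cell's Theorems namespace `Summit.BirchSwinnertonDyer.BirchSwinnertonDyer.…` repeats the summit name by design (D-0017)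
set_option linter.dupNamespace false

open scoped Classical NumberField ContRepresentation
open Function Field NumberField IsDedekindDomain Module
open WeierstrassCurve Literature.NumberTheory.EllipticCurves Literature.NumberTheory.GaloisRepresentations
  Literature.NumberTheory.GaloisRepresentations.DiscreteGaloisModule Literature.NumberTheory.GaloisCohomology
open Summit.BirchSwinnertonDyer.Rank1Residual.GaloisImage
open Summit.BirchSwinnertonDyer.Rank1Residual.GaloisImage.KSDevissage
open Summit.BirchSwinnertonDyer.Rank1Residual.GaloisImage.TorsionLevel
open Summit.BirchSwinnertonDyer.BirchSwinnertonDyer.Theorems.KimAtThreeD7uTamagawaCartesian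
open Summit.BirchSwinnertonDyer.BirchSwinnertonDyer.Theorems.KimAtThreeD7uTamagawaDefect

/-! ### §1 The vanishing dévissage (any number field, any modules) -/

namespace Summit.BirchSwinnertonDyer.BirchSwinnertonDyer.Theorems.KimAtThreeD7uTamagawaDefectDevissage

section Abstract

universe u

variable {K : Type u} [Field K] [NumberField K]
variable {M₁ : Type u} [AddCommGroup M₁] [TopologicalSpace M₁] [DiscreteTopology M₁]
  {M₂ : Type u} [AddCommGroup M₂] [TopologicalSpace M₂] [DiscreteTopology M₂]
  {M₃ : Type u} [AddCommGroup M₃] [TopologicalSpace M₃] [DiscreteTopology M₃]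
variable {ρ₁ : DiscreteGaloisModule K M₁} {ρ₂ : DiscreteGaloisModule K M₂}
  {ρ₃ : DiscreteGaloisModule K M₃}

/-- **Vanishing dévissage for Kolyvagin systems**: along `M₁ →(i) M₂ →(π) M₃` with
`H¹(K, M₁) → H¹(K, M₂) → H¹(K, M₃)` exact at the middle and `i_*` injective, with Kolyvagin data
`D₁, D₂, D₃` on the same primes and Selmer structures `𝓕₁, 𝓕₂, 𝓕₃` satisfying the push-forward
hypotheses of n1011-p15's `isKolyvaginSystem_map` (for `π`) and the pull-back (CARTESIAN) hypotheses of
`isKolyvaginSystem_lift` (for `i`): if every Kolyvagin system of `(D₁, 𝓕₁)` and of `(D₃, 𝓕₃)` vanishes,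
so does every Kolyvagin system of `(D₂, 𝓕₂)` (`π_* κ = 0`, so `κ = i_* λ` with `λ` a Kolyvagin system,
`= 0`).  The length-induction step of [MR04] Thm. 4.2.2 / Büyükboduk Cor. 2.8 in the tree's currency.
[cite: Buyukboduk2009TamagawaDefect, Cor. 2.8 (§2.4)] [cite: Sakamoto2024, Def. 3.5 (p. 923) and Def. 4.1 (p. 926)] -/
theorem apply_eq_zero_of_devissage_of_forall
    (i : ρ₁.toContRepresentation →ⁱL ρ₂.toContRepresentation)
    (π : ρ₂.toContRepresentation →ⁱL ρ₃.toContRepresentation)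
    (hexact : ∀ x, galoisCohomology.map π 1 x = 0 → ∃ y, galoisCohomology.map i 1 y = x)
    (hinji : Function.Injective (galoisCohomology.map i 1))
    {D₁ : KolyvaginDatum ρ₁} {D₂ : KolyvaginDatum ρ₂} {D₃ : KolyvaginDatum ρ₃}
    (hP₁ : D₁.primes = D₂.primes) (hP₃ : D₃.primes = D₂.primes)
    {𝓕₁ : SelmerStructure ρ₁} {𝓕₂ : SelmerStructure ρ₂} {𝓕₃ : SelmerStructure ρ₃}
    (hur₁ : ∀ q ∈ D₂.primes, 𝓕₁ (Sum.inr q) ≤ unramifiedSubgroup (GaloisRep.toLocal q ρ₁) 1)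
    (hur₂ : ∀ q ∈ D₂.primes, 𝓕₂ (Sum.inr q) ≤ unramifiedSubgroup (GaloisRep.toLocal q ρ₂) 1)
    (hFπ : ∀ v, ∀ y ∈ 𝓕₂ v, localMap π v y ∈ 𝓕₃ v)
    (hTπ : ∀ q ∈ D₂.primes, ∀ y ∈ D₂.transverse (Sum.inr q),
      localMap π (Sum.inr q) y ∈ D₃.transverse (Sum.inr q))
    (hfsπ : ∀ q ∈ D₂.primes, ∀ y ∈ unramifiedSubgroup (GaloisRep.toLocal q ρ₂) 1,
      ∀ w : galoisCohomology (GaloisRep.toLocal q ρ₂) 1,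
        singularMap (GaloisRep.toLocal q ρ₂) w = D₂.fs q y →
          singularMap (GaloisRep.toLocal q ρ₃) (localMap π (Sum.inr q) w) =
            D₃.fs q (localMap π (Sum.inr q) y))
    (hFi : ∀ v x, localMap i v x ∈ 𝓕₂ v → x ∈ 𝓕₁ v)
    (hTi : ∀ q ∈ D₂.primes, ∀ x, localMap i (Sum.inr q) x ∈ D₂.transverse (Sum.inr q) →
      x ∈ D₁.transverse (Sum.inr q))
    (hfsi : ∀ q ∈ D₂.primes, ∀ y ∈ unramifiedSubgroup (GaloisRep.toLocal q ρ₁) 1,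
      ∀ w : galoisCohomology (GaloisRep.toLocal q ρ₁) 1,
        singularMap (GaloisRep.toLocal q ρ₂) (localMap i (Sum.inr q) w) =
            D₂.fs q (localMap i (Sum.inr q) y) →
          singularMap (GaloisRep.toLocal q ρ₁) w = D₁.fs q y)
    (h₁ : ∀ lam : Finset (HeightOneSpectrum (𝓞 K)) → galoisCohomology ρ₁ 1,
      D₁.IsKolyvaginSystem 𝓕₁ lam → ∀ n, lam n = 0)
    (h₃ : ∀ μ : Finset (HeightOneSpectrum (𝓞 K)) → galoisCohomology ρ₃ 1,
      D₃.IsKolyvaginSystem 𝓕₃ μ → ∀ n, μ n = 0)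
    {κ : Finset (HeightOneSpectrum (𝓞 K)) → galoisCohomology ρ₂ 1}
    (hκ : D₂.IsKolyvaginSystem 𝓕₂ κ) (n : Finset (HeightOneSpectrum (𝓞 K))) : κ n = 0 := by
  -- push forward: `π_* κ` is a Kolyvagin system for `(D₃, 𝓕₃)`, hence zero
  have hπκ : D₃.IsKolyvaginSystem 𝓕₃ (fun d => galoisCohomology.map π 1 (κ d)) :=
    isKolyvaginSystem_map π hP₃ hur₂ hFπ hTπ hfsπ hκ
  have hzero : ∀ d, galoisCohomology.map π 1 (κ d) = 0 := h₃ _ hπκ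
  -- lift: `κ = i_* λ` with `λ` a Kolyvagin system for `(D₁, 𝓕₁)`, hence zero
  obtain ⟨lam, hlam, hlam0⟩ :=
    exists_lift_of_forall_mem_range i hinji (fun d => hexact (κ d) (hzero d))
  have hlamKS : D₁.IsKolyvaginSystem 𝓕₁ lam :=
    isKolyvaginSystem_lift i hP₁ hur₁ hFi hTi hfsi hκ hlam hlam0
  rw [← hlam n, h₁ lam hlamKS n, map_zero]

end Abstract

/-! ### §2 The step `k ⟹ k + 1` for `𝓕_{u-ℓ}` on `E[3^{k+1}·3]` -/

section Step

variable (W : WeierstrassCurve ℚ) [W.IsElliptic]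

/-- Local notation: `𝓕_{u-ℓ}^{(j)}` = Mazur–Rubin's propagated structure on `E[3^j·3]` with its condition at
`ℓ` replaced by [MR04]'s unramified condition `𝓕_u(ℓ)_j = im(H¹_ur(ℚ_ℓ, T₃E) → H¹(ℚ_ℓ, E[3^j·3]))`
(Büyükboduk's `𝓕_{u-ℓ}` propagated to `T/3^{j+1}`). -/
local notation3 "𝓕uℓ[" W' ", " ℓ' ", " j ", " L' "]" =>
  Function.update (propagatedSelmerStructure W' 3 j) (Sum.inr ℓ')
    (blochKatoSelmerStructure 3 (tateTorsionDatum W' 3 j) L' (Sum.inr ℓ'))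

/-- Off the modified place, an updated Selmer structure is the original one (`Function.update_of_ne`,
restated with all arguments explicit so that rewriting is syntactic). [folklore] -/
theorem update_inr_apply_of_ne {M : Type} [AddCommGroup M] [TopologicalSpace M] [DiscreteTopology M]
    {ρ : DiscreteGaloisModule ℚ M} (𝓕 : SelmerStructure ρ) (ℓ : HeightOneSpectrum (𝓞 ℚ))
    (F : AddSubgroup (galoisCohomology (ρ.toLocal (Sum.inr ℓ)) 1)) {v : Place ℚ} (hv : v ≠ Sum.inr ℓ) :
    Function.update 𝓕 (Sum.inr ℓ) F v = 𝓕 v :=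
  Function.update_of_ne hv F 𝓕

/-- At the modified place, an updated Selmer structure is the new condition (`Function.update_self`).
[folklore] -/
theorem update_inr_apply_self {M : Type} [AddCommGroup M] [TopologicalSpace M] [DiscreteTopology M]
    {ρ : DiscreteGaloisModule ℚ M} (𝓕 : SelmerStructure ρ) (ℓ : HeightOneSpectrum (𝓞 ℚ))
    (F : AddSubgroup (galoisCohomology (ρ.toLocal (Sum.inr ℓ)) 1)) :
    Function.update 𝓕 (Sum.inr ℓ) F (Sum.inr ℓ) = F :=
  Function.update_self (Sum.inr ℓ) F 𝓕

/-- **The dévissage step for `𝓕_{u-ℓ}`** (n1011-p11 GEN 6's `apply_eq_zero_of_apply_eq_zero_succ` with the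
structure modified at `ℓ` and the conclusion «every Kolyvagin system vanishes»).  `W/ℚ` elliptic with no
`Γ_ℚ`-fixed point on `E[3^k·3]`; `S` a finite set of places containing `ℓ` (a finite place with `ℓ ∤ 3`)
outside which `𝓕_can` on `E[3^{k+1}·3]` and `𝓕̄_can` on `E[3]` are unramified; `τ ∈ Gal(ℚ̄/ℚ(μ_{3^{k+2}}))`
with cyclic cokernels on the three modules; Kolyvagin data `D₂`, `D₃`, `D₁` on `E[3^{k+1}·3]`, `E[3^k·3]`,
`E[3]` with the SAME primes inside Sakamoto's class at level `3^{k+2}` and outside `S`, cyclotomic transverse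
conditions, THE canonical comparison maps for ONE `η`, `D₂` admissible; local conditions `L₂, L₃` above
`3` (irrelevant at `ℓ`).  CARTESIAN INPUT at `ℓ`: a condition `F₁` on `E[3]` at `ℓ` containing every class
whose image under `incl_*` lies in `𝓕_u(ℓ)_{k+1}` (`hF₁`; part XI supplies `F₁ = 𝓕_u(ℓ)_0` under
`Φ_ℓ[3^{k+1}] ⊆ 3Φ_ℓ`).  If every Kolyvagin system of `(E[3], (𝓕̄_can off ℓ, F₁ at ℓ), D₁)` and of
`(E[3^k·3], 𝓕_{u-ℓ}^{(k)}, D₃)` vanishes, then so does every Kolyvagin system of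
`(E[3^{k+1}·3], 𝓕_{u-ℓ}^{(k+1)}, D₂)`.
[cite: Buyukboduk2009TamagawaDefect, Prop. 2.7 and Cor. 2.8 (§2.4)] [cite: Sakamoto2024, Def. 3.5 (p. 923) and Thm. 4.4 (1) (p. 926)] -/
theorem apply_eq_zero_blochKatoUpdate_succ [Finite (geomTorsion W ((3 : ℕ) : ℤ))] (k : ℕ)
    (h0 : ∀ P : geomTorsion W (((3 : ℕ) : ℤ) ^ k * ((3 : ℕ) : ℤ)),
      (∀ σ : absoluteGaloisGroup ℚ,
        W.torsionGaloisModule (((3 : ℕ) : ℤ) ^ k * ((3 : ℕ) : ℤ)) σ P = P) → P = 0)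
    {S : Finset (Place ℚ)}
    (h𝓕₂ : (propagatedSelmerStructure W 3 (k + 1)).IsUnramifiedOutside S)
    (h𝓕₁ : (propagatedSelmerStructureOne W 3).IsUnramifiedOutside S)
    {ℓ : HeightOneSpectrum (𝓞 ℚ)} (h3ℓ : ((3 : ℕ) : 𝓞 ℚ) ∉ ℓ.asIdeal) (hℓS : (Sum.inr ℓ : Place ℚ) ∈ S)
    (L₂ : (tateTorsionDatum W 3 (k + 1)).LocalConditionsAbove 3)
    (L₃ : (tateTorsionDatum W 3 k).LocalConditionsAbove 3)
    (F₁ : AddSubgroup (galoisCohomology ((W.torsionGaloisModule ((3 : ℕ) : ℤ)).toLocal (Sum.inr ℓ)) 1))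
    (hF₁ : ∀ x : galoisCohomology ((W.torsionGaloisModule ((3 : ℕ) : ℤ)).toLocal (Sum.inr ℓ)) 1,
      localMap (W.torsionInclusion (three_dvd_pow_succ_mul k)) (Sum.inr ℓ) x ∈
        blochKatoSelmerStructure 3 (tateTorsionDatum W 3 (k + 1)) L₂ (Sum.inr ℓ) → x ∈ F₁)
    {Sset : Set (HeightOneSpectrum (𝓞 ℚ))} {τ : absoluteGaloisGroup ℚ}
    (hτμ : τ ∈ rootsOfUnityFixer ℚ (3 ^ (k + 1 + 1)))
    (hτ₂ : Nonempty (cokerSubOne (W.torsionGaloisModule (((3 : ℕ) : ℤ) ^ (k + 1) * ((3 : ℕ) : ℤ))) τ ≃+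
      ZMod (3 ^ (k + 1 + 1))))
    (hτ₃ : Nonempty (cokerSubOne (W.torsionGaloisModule (((3 : ℕ) : ℤ) ^ k * ((3 : ℕ) : ℤ))) τ ≃+
      ZMod (3 ^ (k + 1))))
    (hτ₁ : Nonempty (cokerSubOne (W.torsionGaloisModule ((3 : ℕ) : ℤ)) τ ≃+ ZMod 3))
    {D₂ : KolyvaginDatum (W.torsionGaloisModule (((3 : ℕ) : ℤ) ^ (k + 1) * ((3 : ℕ) : ℤ)))}
    {D₃ : KolyvaginDatum (W.torsionGaloisModule (((3 : ℕ) : ℤ) ^ k * ((3 : ℕ) : ℤ)))}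
    {D₁ : KolyvaginDatum (W.torsionGaloisModule ((3 : ℕ) : ℤ))}
    (hP₁ : D₁.primes = D₂.primes) (hP₃ : D₃.primes = D₂.primes)
    (hP₂ : D₂.primes ⊆ frobeniusClassPrimes
      (W.torsionGaloisModule (((3 : ℕ) : ℤ) ^ (k + 1) * ((3 : ℕ) : ℤ))) Sset τ (3 ^ (k + 1 + 1)))
    (hPS : ∀ q ∈ D₂.primes, (Sum.inr q : Place ℚ) ∉ S)
    (hT₂ : D₂.transverse = cyclotomicTransverse _) (hT₃ : D₃.transverse = cyclotomicTransverse _)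
    (hT₁ : D₁.transverse = cyclotomicTransverse _)
    {η : (q : HeightOneSpectrum (𝓞 ℚ)) → (ZMod (Ideal.absNorm q.asIdeal))ˣ}
    (hD₂ : D₂.HasCanonicalComparison (3 ^ (k + 1 + 1)) η) (hD₃ : D₃.HasCanonicalComparison (3 ^ (k + 1)) η)
    (hD₁ : D₁.HasCanonicalComparison 3 η) (hadm₂ : D₂.IsAdmissible)
    (h₁ : ∀ lam : Finset (HeightOneSpectrum (𝓞 ℚ)) →
        galoisCohomology (W.torsionGaloisModule ((3 : ℕ) : ℤ)) 1,
      D₁.IsKolyvaginSystem (Function.update (propagatedSelmerStructureOne W 3) (Sum.inr ℓ) F₁)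
        lam → ∀ n, lam n = 0)
    (h₃ : ∀ μ : Finset (HeightOneSpectrum (𝓞 ℚ)) →
        galoisCohomology (W.torsionGaloisModule (((3 : ℕ) : ℤ) ^ k * ((3 : ℕ) : ℤ))) 1,
      D₃.IsKolyvaginSystem 𝓕uℓ[W, ℓ, k, L₃] μ → ∀ n, μ n = 0)
    {κ : Finset (HeightOneSpectrum (𝓞 ℚ)) →
      galoisCohomology (W.torsionGaloisModule (((3 : ℕ) : ℤ) ^ (k + 1) * ((3 : ℕ) : ℤ))) 1}
    (hκ : D₂.IsKolyvaginSystem 𝓕uℓ[W, ℓ, k + 1, L₂] κ)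
    (n : Finset (HeightOneSpectrum (𝓞 ℚ))) : κ n = 0 := by
  haveI : Fact (Nat.Prime 3) := ⟨Nat.prime_three⟩
  haveI : Fact (1 < 3) := ⟨by norm_num⟩
  haveI : Fact (1 < 3 ^ (k + 1)) := ⟨Nat.one_lt_pow (Nat.succ_ne_zero _) (by norm_num)⟩
  haveI : NeZero (3 ^ (k + 1 + 1)) := ⟨pow_ne_zero _ (by norm_num)⟩
  haveI : NeZero (3 ^ (k + 1)) := ⟨pow_ne_zero _ (by norm_num)⟩
  haveI : Finite (geomTorsion W (((3 : ℕ) : ℤ) ^ (k + 1) * ((3 : ℕ) : ℤ))) :=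
    finite_geomTorsion_pow_mul W 3 (k + 1)
  haveI : Finite (geomTorsion W (((3 : ℕ) : ℤ) ^ k * ((3 : ℕ) : ℤ))) := finite_geomTorsion_pow_mul W 3 k
  -- the reduction `red : E[3^{k+1}·3] → E[3^k·3]`, `x ↦ 3x`
  obtain ⟨red, hred'⟩ := exists_torsionReduction_pow_mul W 3 k (k + 1)
  have hred : ∀ x : geomTorsion W (((3 : ℕ) : ℤ) ^ (k + 1) * ((3 : ℕ) : ℤ)),
      ((red x : geomTorsion W (((3 : ℕ) : ℤ) ^ k * ((3 : ℕ) : ℤ))) : geomPoints W) =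
        ((3 : ℕ) : ℤ) • (x : geomPoints W) := fun x => by
    rw [hred', Nat.add_sub_cancel_left, pow_one]
  set incl := W.torsionInclusion (three_dvd_pow_succ_mul k) with hincl
  -- places of the datum are different from `ℓ`
  have hqℓ : ∀ q ∈ D₂.primes, (Sum.inr q : Place ℚ) ≠ Sum.inr ℓ := fun q hq h => hPS q hq (h ▸ hℓS)
  -- divisibilities, sub-classes, roots of unity, exponents
  have hdvd₂₃ : 3 ^ (k + 1) ∣ 3 ^ (k + 1 + 1) := pow_dvd_pow 3 (Nat.le_succ _)
  have hdvd₂₁ : 3 ∣ 3 ^ (k + 1 + 1) := dvd_pow_self 3 (Nat.succ_ne_zero _)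
  have hker₃ : ∀ u : absoluteGaloisGroup ℚ, (W.torsionGaloisModule (((3 : ℕ) : ℤ) ^ (k + 1) * ((3 : ℕ) : ℤ))) u = 1 → (W.torsionGaloisModule (((3 : ℕ) : ℤ) ^ k * ((3 : ℕ) : ℤ))) u = 1 := fun u hu =>
    torsionGaloisModule_eq_one_of_dvd W (Transport.pow_mul_dvd_pow_mul (Nat.le_succ k)) u hu
  have hker₁ : ∀ u : absoluteGaloisGroup ℚ, (W.torsionGaloisModule (((3 : ℕ) : ℤ) ^ (k + 1) * ((3 : ℕ) : ℤ))) u = 1 → (W.torsionGaloisModule ((3 : ℕ) : ℤ)) u = 1 := fun u hu =>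
    torsionGaloisModule_eq_one_of_dvd W (three_dvd_pow_succ_mul k) u hu
  have hmono₃ : ∀ q ∈ D₂.primes, q ∈ frobeniusClassPrimes (W.torsionGaloisModule (((3 : ℕ) : ℤ) ^ k * ((3 : ℕ) : ℤ))) Sset τ (3 ^ (k + 1)) := fun q hq =>
    S24Deep.frobeniusClassPrimes_mono (W.torsionGaloisModule (((3 : ℕ) : ℤ) ^ k * ((3 : ℕ) : ℤ))) (W.torsionGaloisModule (((3 : ℕ) : ℤ) ^ (k + 1) * ((3 : ℕ) : ℤ))) hker₃ Sset τ hdvd₂₃ (hP₂ hq)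
  have hmono₁ : ∀ q ∈ D₂.primes, q ∈ frobeniusClassPrimes (W.torsionGaloisModule ((3 : ℕ) : ℤ)) Sset τ 3 := fun q hq =>
    S24Deep.frobeniusClassPrimes_mono (W.torsionGaloisModule ((3 : ℕ) : ℤ)) (W.torsionGaloisModule (((3 : ℕ) : ℤ) ^ (k + 1) * ((3 : ℕ) : ℤ))) hker₁ Sset τ hdvd₂₁ (hP₂ hq)
  have hτμ₁ : τ ∈ rootsOfUnityFixer ℚ 3 := rootsOfUnityFixer_le_of_dvd ℚ hdvd₂₁ hτμ
  have hM₂ : ∀ m : geomTorsion W (((3 : ℕ) : ℤ) ^ (k + 1) * ((3 : ℕ) : ℤ)), 3 ^ (k + 1 + 1) • m = 0 :=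
    pow_succ_nsmul_geomTorsion_eq_zero W 3 (k + 1)
  have hM₁ : ∀ m : geomTorsion W ((3 : ℕ) : ℤ), 3 • m = 0 := three_nsmul_geomTorsion_three W
  -- per-prime instances and local shapes
  have hprime : ∀ q : HeightOneSpectrum (𝓞 ℚ), Fact (Ideal.absNorm q.asIdeal).Prime :=
    fun q => ⟨FSComp.prime_absNorm_rat q⟩
  have hne : ∀ q : HeightOneSpectrum (𝓞 ℚ),
      NeZero ((Ideal.absNorm q.asIdeal : ℕ) : q.adicCompletion ℚ) := fun q => by
    haveI : CharZero (q.adicCompletion ℚ) :=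
      charZero_of_injective_algebraMap (algebraMap ℚ (q.adicCompletion ℚ)).injective
    exact ⟨Nat.cast_ne_zero.2 (FSComp.prime_absNorm_rat q).ne_zero⟩
  have hsup₁ : ∀ q ∈ D₂.primes, unramifiedSubgroup (GaloisRep.toLocal q (W.torsionGaloisModule ((3 : ℕ) : ℤ))) 1 ⊔
      cyclotomicTransverse (W.torsionGaloisModule ((3 : ℕ) : ℤ)) (Sum.inr q) = ⊤ := fun q hq => by
    haveI := hprime q; haveI := hne q
    exact unramifiedSubgroup_sup_cyclotomicTransverse_eq_top_of_mem_frobeniusClassPrimes (W.torsionGaloisModule ((3 : ℕ) : ℤ)) (hmono₁ q hq)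
      (absNorm_sub_one_smul_eq_zero_of_mem_frobeniusClassPrimes (W.torsionGaloisModule ((3 : ℕ) : ℤ)) (hmono₁ q hq) hτμ₁ hM₁)
      (modPCyclotomicCharacter_surjOn_absInertia_rat_holds q)
  have hM₂' : ∀ q ∈ D₂.primes, ∀ m : geomTorsion W (((3 : ℕ) : ℤ) ^ (k + 1) * ((3 : ℕ) : ℤ)),
      (Ideal.absNorm q.asIdeal - 1) • m = 0 := fun q hq =>
    absNorm_sub_one_smul_eq_zero_of_mem_frobeniusClassPrimes (W.torsionGaloisModule (((3 : ℕ) : ℤ) ^ (k + 1) * ((3 : ℕ) : ℤ))) (hP₂ hq) hτμ hM₂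
  have hU₂ : ∀ q ∈ D₂.primes,
      Nat.card (unramifiedSubgroup (GaloisRep.toLocal q (W.torsionGaloisModule (((3 : ℕ) : ℤ) ^ (k + 1) * ((3 : ℕ) : ℤ)))) 1) = 3 ^ (k + 1 + 1) := fun q hq =>
    natCard_unramifiedSubgroup_toLocal_of_mem_frobeniusClassPrimes (W.torsionGaloisModule (((3 : ℕ) : ℤ) ^ (k + 1) * ((3 : ℕ) : ℤ))) (hP₂ hq) hτ₂
  have hTc₂ : ∀ q ∈ D₂.primes, Nat.card (D₂.transverse (Sum.inr q)) = 3 ^ (k + 1 + 1) := fun q hq => by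
    haveI := hprime q; haveI := hne q
    rw [hT₂]
    exact natCard_cyclotomicTransverse_rat_of_mem_frobeniusClassPrimes' (W.torsionGaloisModule (((3 : ℕ) : ℤ) ^ (k + 1) * ((3 : ℕ) : ℤ))) (hP₂ hq) hτ₂ (hM₂' q hq)
  have hUT₂ : ∀ q ∈ D₂.primes, unramifiedSubgroup (GaloisRep.toLocal q (W.torsionGaloisModule (((3 : ℕ) : ℤ) ^ (k + 1) * ((3 : ℕ) : ℤ)))) 1 ⊔
      D₂.transverse (Sum.inr q) = ⊤ := fun q hq => by
    haveI := hprime q; haveI := hne q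
    rw [hT₂]
    exact unramifiedSubgroup_sup_cyclotomicTransverse_eq_top_of_mem_frobeniusClassPrimes (W.torsionGaloisModule (((3 : ℕ) : ℤ) ^ (k + 1) * ((3 : ℕ) : ℤ))) (hP₂ hq)
      (hM₂' q hq) (modPCyclotomicCharacter_surjOn_absInertia_rat_holds q)
  have hinf₂ : ∀ q ∈ D₂.primes, unramifiedSubgroup (GaloisRep.toLocal q (W.torsionGaloisModule (((3 : ℕ) : ℤ) ^ (k + 1) * ((3 : ℕ) : ℤ)))) 1 ⊓
      cyclotomicTransverse (W.torsionGaloisModule (((3 : ℕ) : ℤ) ^ (k + 1) * ((3 : ℕ) : ℤ))) (Sum.inr q) = ⊥ := fun q hq => by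
    rw [← hT₂]
    exact CoreRankOne.unramified_inf_transverse_eq_bot hadm₂ hU₂ hTc₂ hUT₂ hq
  have hinjloc : ∀ q ∈ D₂.primes, Function.Injective (localMap incl (Sum.inr q)) := fun q hq =>
    localMap_torsionInclusion_injective W k red hred q
      (natCard_invariants_toLocal_of_mem_frobeniusClassPrimes (W.torsionGaloisModule (((3 : ℕ) : ℤ) ^ (k + 1) * ((3 : ℕ) : ℤ))) (hP₂ hq) hτ₂)
      (natCard_invariants_toLocal_of_mem_frobeniusClassPrimes (W.torsionGaloisModule (((3 : ℕ) : ℤ) ^ k * ((3 : ℕ) : ℤ))) (hmono₃ q hq) hτ₃)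
      (natCard_invariants_toLocal_of_mem_frobeniusClassPrimes (W.torsionGaloisModule ((3 : ℕ) : ℤ)) (hmono₁ q hq) hτ₁)
  -- matched bases for the two comparison compatibilities
  obtain ⟨n₂, b, b', hb⟩ := exists_bases_red W k red hred
  obtain ⟨n₁, c, c', hc⟩ := exists_bases_torsionMulBy W k
  refine apply_eq_zero_of_devissage_of_forall incl red
    (exists_map_torsionInclusion_eq_of_map_red_eq_zero W k red hred)
    (map_torsionInclusion_injective W k red hred h0) hP₁ hP₃
    (fun q hq => ?_) (fun q hq => ?_)
    ?_ ?_ ?_ ?_ ?_ ?_ h₁ h₃ hκ n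
  · -- `𝓕₁ ≤ H¹_ur` at the primes (`q ≠ ℓ`)
    rw [update_inr_apply_of_ne (propagatedSelmerStructureOne W 3) ℓ F₁ (hqℓ q hq)]
    exact (h𝓕₁.2 q (hPS q hq)).le
  · -- `𝓕₂ ≤ H¹_ur` at the primes (`q ≠ ℓ`)
    rw [update_inr_apply_of_ne (propagatedSelmerStructure W 3 (k + 1)) ℓ _ (hqℓ q hq)]
    exact (h𝓕₂.2 q (hPS q hq)).le
  · -- PUSH `𝓕_{u-ℓ}^{(k+1)} → 𝓕_{u-ℓ}^{(k)}`: part XI §2 at `ℓ`, n1011 `𝓕_can` elsewhere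
    intro v y hy
    by_cases hv : v = Sum.inr ℓ
    · subst hv
      rw [update_inr_apply_self] at hy ⊢
      exact localMap_red_mem_blochKatoSelmerStructure W 3 k ℓ (Nat.le_succ k) red (hred_pow W k red hred)
        h3ℓ L₂ L₃ hy
    · rw [update_inr_apply_of_ne _ ℓ _ hv] at hy ⊢
      exact localMap_red_mem_propagatedSelmerStructure W k red hred v hy
  · -- transverse push
    intro q hq y hy
    rw [hT₂] at hy
    rw [hT₃]
    exact localMap_mem_cyclotomicTransverse red q hy
  · -- comparison transport (n1011-p15 F-B1b)
    intro q hq y hy w hw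
    exact singularMap_localMap_eq_fs_of_hasCanonicalComparison hdvd₂₃ red b b' hb hD₂ hD₃ hq
      (hP₃.symm ▸ hq) (hP₂ hq).2.2.1 (hmono₃ q hq).2.2.1 hy w hw
  · -- PULL (cartesian): `hF₁` at `ℓ` (part XI §1), n1011-p13 elsewhere
    intro v x hx
    by_cases hv : v = Sum.inr ℓ
    · subst hv
      rw [update_inr_apply_self] at hx
      rw [update_inr_apply_self (propagatedSelmerStructureOne W 3) ℓ F₁]
      exact hF₁ x hx
    · rw [update_inr_apply_of_ne _ ℓ _ hv] at hx
      rw [update_inr_apply_of_ne (propagatedSelmerStructureOne W 3) ℓ F₁ hv]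
      exact mem_propagatedSelmerStructureOne_of_localMap_torsionInclusion_mem W k v x hx
  · -- transverse pull-back
    intro q hq x hx
    rw [hT₂] at hx
    rw [hT₁]
    exact mem_cyclotomicTransverse_of_localMap_mem incl q (hsup₁ q hq) (hinf₂ q hq) (hinjloc q hq) hx
  · -- comparison reflection (n1011-p15 F-B1b), through `[3^{k+1}] : E[3^{k+1}·3] ↠ E[3]`
    intro q hq y hy w hw
    exact singularMap_eq_fs_of_localMap_of_hasCanonicalComparison hdvd₂₁
      (W.torsionMulBy (((3 : ℕ) : ℤ) ^ (k + 1)) ((3 : ℕ) : ℤ)) c c' hc incl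
      (isSES_torsionInclusion_red W k red hred).injective hD₂ hD₁ hq (hP₁.symm ▸ hq) (hP₂ hq).2.2.1
      (hmono₁ q hq).2.2.1 hy w hw

end Step

end Summit.BirchSwinnertonDyer.BirchSwinnertonDyer.Theorems.KimAtThreeD7uTamagawaDefectDevissage

end
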